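import Summits.Ventures.HSemireg.Pad4TowerXInfB

/-!
# Venture HSemireg — PAD-4: THEOREM X∞ in the kernel, part B2 — (B3), (B6), LEMMA X∞-B and THEOREM X∞ ((F1ℝ) slice, 𝒰 unbounded)

HONEST FRAMING. Sequel of `Pad4TowerXInfB` (same sources, same scope, same honest framing — read its module docstring; bc5-plan g4
memo `BC5-PLAN-g4-MEMO.md` v4.1 df3e4f41db3c2fcf, THEOREM X∞ pencil ×1 at typing time, LEG A ∕ LEG B reads routed). THIS FILE closes
the proof: `no_big_ray` ((B3)–(B5): no ray of the maximal charge `R ≥ 2` in the fully charged world — a `P` carrying it is all-ray by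
(B2) and dies by (B4)+(B5); an `N` carrying it has a second ray served own-down to such a `P`, or two towers, (B2)), `allTower_of_unit`
((B6): with unit rays only, the fully charged world has no zero coordinate), `Admissible.no_fc` (**LEMMA X∞-B**: the fully charged
world is EMPTY — largest ray charge via `Finset.exists_max_image`: `≥ 2` is (B3)–(B5), `≤ 1` is (B6)+(B1), no ray is (B1)), then
`Admissible.three_O` (**THEOREM X∞**: every cell of an admissible configuration has at least three O-factors) and `xinf_muC_eq_zero`
(**the design corollary: μ = 0, no Ψ-row hypothesis**). NOT IN LEAN: the (E1)∕(H2) meaning of RULE D and of X-cleanness (pencil, LEG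
A's object); G-invariant ⇒ PSC; μ₄ phases `±i`. Nothing is a statement about a variety, a sheaf, σ, a seed or an abelian variety;
NOTHING HERE SAYS THAT HC ∕ HC_CM ∕ HC_AV ∕ W₆ ∕ HC_Kum4Type HOLDS OR FAILS. No `instance`, no notation, no named fact, 0 `sorry`;
axioms standard (`three_O`, `xinf_muC_eq_zero`: propext, Classical.choice, Quot.sound).
-/

namespace Summit.Ventures.HSemireg.Pad4Tower

open Finset

/-! ## §5 (B3) and (B6): no ray of charge ≥ 2 at all; with unit rays only the world is all-tower -/

section Main
variable {C : Config} (hA : Admissible C)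
include hA

/-- (B3)–(B5): if all ray charges of the fully charged world are `≤ R` with `R ≥ 2`, no fully charged cell carries a ray of charge `R`.
(A `P` carrying it is all-ray by (B2) and dies by (B4)+(B5); an `N` carrying it either has a second ray — served own-down to a `P`
carrying `R` — or two towers, (B2).) -/
theorem Admissible.no_big_ray {R : ℕ} (hR : ∀ Y, (Y ∈ C.lower ∨ Y ∈ C.upper) → FC Y → ∀ k t, Y k t.rev = 0 → Y k t ≤ R)
    (h2 : 2 ≤ R) {X : Cell} (hX : X ∈ C.lower ∨ X ∈ C.upper) (hfc : FC X) {k : Fin 4} {u : Fin 2} (hku : X k u = R)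
    (hku' : X k u.rev = 0) : False := by
  have allray : ∀ Q ∈ C.upper, FC Q → ∀ k' u', Q k' u' = R → Q k' u'.rev = 0 → False := by
    intro Q hQu hQfc k' u' hQk hQk'
    have hw : ∀ m, ∃ t : Fin 2, Q m t ≠ 0 ∧ Q m t.rev = 0 := fun m => by
      rcases ray_or_tower (hA.uP Q hQu) hQfc m with h | ⟨v, hv, hv'⟩
      · exact h
      · exfalso
        by_cases hmk : m = k'
        · subst hmk
          rcases (show u'.rev = v ∨ u'.rev = v.rev by fin_cases u' <;> fin_cases v <;> decide) with e | e
          · rw [e] at hQk'; omega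
          · rw [e] at hQk'; omega
        · exact hA.b2_upper hR h2 hQu hQfc hmk hv hv' hQk hQk'
    choose w hw1 hw0 using hw
    have hk : Q k' (w k') = R := by
      by_cases h : w k' = u'
      · rw [h]; exact hQk
      · have : u' = (w k').rev := Fin2.eq_rev_of_ne _ _ (Ne.symm h)
        rw [this, hw0] at hQk; omega
    exact hA.b45 hR h2 hQu hQfc w hw0 hk
  rcases hX with hXl | hXu
  · by_cases hex : ∃ k', k' ≠ k ∧ ∃ u' : Fin 2, X k' u' ≠ 0 ∧ X k' u'.rev = 0
    · obtain ⟨k', hk'k, u', h1, h0⟩ := hex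
      obtain ⟨P, hPu, hag, -⟩ := servedBelow_of_zero C (hA.ruleD.1 X hXl) hku' hk'k h1
      obtain ⟨a, hak, hak', -⟩ := exists_fourth k k' k'
      have hPk : ∀ r, P k r = X k r := fun r => hag k r (fun h => hk'k.symm h.1)
      have hPa : ∀ r, P a r = X a r := fun r => hag a r (fun h => hak' h.1)
      have hPfc : FC P := hA.fc_of_agree (Or.inr hPu) hfc (Ne.symm hak) hPk hPa
      exact allray P hPu hPfc k u (by rw [hPk]; exact hku) (by rw [hPk]; exact hku')
    · push Not at hex
      obtain ⟨j, hjk, -⟩ := exists_fourth k k k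
      obtain ⟨j', hj'k, hj'j, -⟩ := exists_fourth k j j
      have tw : ∀ i, i ≠ k → ∃ v : Fin 2, 2 ≤ X i v ∧ X i v.rev = 1 := fun i hik => by
        rcases ray_or_tower (hA.uN X hXl) hfc i with ⟨t, ht1, ht0⟩ | h
        · exact absurd ht0 (hex i hik t ht1)
        · exact h
      obtain ⟨v, -, hv'⟩ := tw j hjk
      obtain ⟨v', hv2, hv2'⟩ := tw j' hj'k
      exact hA.b2_lower hR h2 hXl hfc hjk hj'k (Ne.symm hj'j) hv' hv2 hv2' hku hku'
  · exact allray X hXu hfc k u hku hku'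

/-- (B6): if every ray of the fully charged world is a UNIT ray, the fully charged world is all-tower (no zero coordinate).
(`N`: a second ray would have charge `≥ 2`, a tower's `1` would be served below by a ray of charge `≥ 2`; `P`: RULE D at (the ray's
`0`, a tower's `1`) gives an antipodal server `N`, all-tower, so the other three letters are towers, and RULE D between two of them
needs an own-up `N` keeping the ray; an all-ray `P` fails RULE D at (ray `1`, another ray's `0`).) -/
theorem Admissible.allTower_of_unit (h1 : ∀ Y, (Y ∈ C.lower ∨ Y ∈ C.upper) → FC Y → ∀ k t, Y k t.rev = 0 → Y k t ≤ 1) :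
    ∀ X, (X ∈ C.lower ∨ X ∈ C.upper) → FC X → ∀ i r, X i r ≠ 0 := by
  have hN : ∀ N ∈ C.lower, FC N → ∀ i r, N i r ≠ 0 := by
    intro N hNl hfc i r h0
    obtain ⟨j, hji, -⟩ := exists_fourth i i i
    rcases ray_or_tower (hA.uN N hNl) hfc j with ⟨t, ht1, ht0⟩ | ⟨v, -, hv'⟩
    · have := hA.two_le_ray hNl hfc (Ne.symm hji) (u := r.rev) (u' := t) (by rw [Fin.rev_rev]; exact h0) ht1 ht0
      have := h1 N (Or.inl hNl) hfc j t ht0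
      omega
    · obtain ⟨P, hPu, hag, hlt⟩ := servedBelow_of_zero C (hA.ruleD.1 N hNl) h0 hji (g := j) (r := v.rev) (by rw [hv']; decide)
      obtain ⟨a, hai, haj, -⟩ := exists_fourth i j j
      have hPfc : FC P :=
        hA.fc_of_agree (Or.inr hPu) hfc (Ne.symm hai) (fun r' => hag i r' (fun h => hji.symm h.1)) (fun r' => hag a r' (fun h => haj h.1))
      have hP0 : P j v.rev = 0 := by omega
      have hPv : P j v = N j v := hag j v (fun h => ne_rev _ h.2)
      have := h1 P (Or.inr hPu) hPfc j v hP0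
      rcases ray_or_tower (hA.uN N hNl) hfc j with ⟨t, ht1, ht0⟩ | ⟨v₁, hv₁, hv₁'⟩
      · have := hA.two_le_ray hNl hfc (Ne.symm hji) (u := r.rev) (u' := t) (by rw [Fin.rev_rev]; exact h0) ht1 ht0
        have := h1 N (Or.inl hNl) hfc j t ht0
        omega
      · rcases (show v₁ = v ∨ v₁ = v.rev by fin_cases v₁ <;> fin_cases v <;> decide) with e | e
        · rw [e] at hv₁; omega
        · rw [e, Fin.rev_rev] at hv₁'; rw [e] at hv₁; omega
  have hP : ∀ P ∈ C.upper, FC P → ∀ i r, P i r ≠ 0 := by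
    intro P hPu hfc i r h0
    have hi1 : P i r.rev ≠ 0 := fun h => hfc i (isO_of_sides r h0 h)
    by_cases htw : ∃ j, j ≠ i ∧ ∃ v : Fin 2, 2 ≤ P j v ∧ P j v.rev = 1
    · obtain ⟨j, hji, v, hv, hv'⟩ := htw
      -- RULE D at (the ray's 0, the tower's 1): an antipodal server N, all-tower, so every factor ≠ i of P has no zero
      have hnz : ∀ m, m ≠ i → ∀ q, P m q ≠ 0 := by
        rcases hA.ruleD.2 P hPu i j (Ne.symm hji) r v.rev (by omega) with ⟨N, hNl, hag, -⟩ | ⟨N, hNl, hag, hlt⟩ | ⟨N, hNl, hag, -, hlt⟩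
        · obtain ⟨a, hai, haj, -⟩ := exists_fourth i j j
          have hNfc : FC N := hA.fc_of_agree (Or.inl hNl) hfc (Ne.symm haj) (fun q => hag j q (fun h => hji h.1))
            (fun q => hag a q (fun h => hai h.1))
          intro m hmi q
          rw [← hag m q (fun h => hmi h.1)]
          exact hN N hNl hNfc m q
        · have e : N j v = P j v := hag j v (fun h => ne_rev _ h.2)
          have hb := two_le_both (X := N) (j := j) (v := v) (by omega) (by omega)
          exact (not_two_two (hA.uN N hNl) hb.1 hb.2).elim
        · have e : N j v = P j v := hag j v (fun h => hji h.1) (fun h => ne_rev _ h.2)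
          have hb := two_le_both (X := N) (j := j) (v := v) (by omega) (by omega)
          exact (not_two_two (hA.uN N hNl) hb.1 hb.2).elim
      -- a second tower j' ∉ {i, j}; RULE D between the two towers
      obtain ⟨j', hj'i, hj'j, -⟩ := exists_fourth i j j
      obtain ⟨v', hv2, hv2'⟩ : ∃ v' : Fin 2, 2 ≤ P j' v' ∧ P j' v'.rev = 1 := by
        rcases ray_or_tower (hA.uP P hPu) hfc j' with ⟨t, -, ht0⟩ | h
        · exact absurd ht0 (hnz j' hj'i t.rev)
        · exact h
      rcases hA.ruleD.2 P hPu j j' (Ne.symm hj'j) v v'.rev (by omega) with ⟨N, hNl, hag, -⟩ | ⟨N, hNl, hag, hlt⟩ | ⟨N, hNl, hag, -, hlt⟩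
      · have hNfc : FC N := hA.fc_of_agree (Or.inl hNl) hfc hj'i (fun q => hag j' q (fun h => hj'j h.1))
          (fun q => hag i q (fun h => hji.symm h.1))
        exact hN N hNl hNfc i r (by rw [hag i r (fun h => hji.symm h.1)]; exact h0)
      · have e : N j' v' = P j' v' := hag j' v' (fun h => ne_rev _ h.2)
        have hb := two_le_both (X := N) (j := j') (v := v') (by omega) (by omega)
        exact not_two_two (hA.uN N hNl) hb.1 hb.2
      · have e : N j' v' = P j' v' := hag j' v' (fun h => hj'j h.1) (fun h => ne_rev _ h.2)
        have hb := two_le_both (X := N) (j := j') (v := v') (by omega) (by omega)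
        exact not_two_two (hA.uN N hNl) hb.1 hb.2
    · -- all other factors are rays: RULE D at (the ray's 1, another ray's 0)
      push Not at htw
      obtain ⟨m, hmi, -⟩ := exists_fourth i i i
      obtain ⟨t, ht1, ht0⟩ : ∃ t : Fin 2, P m t ≠ 0 ∧ P m t.rev = 0 := by
        rcases ray_or_tower (hA.uP P hPu) hfc m with h | ⟨v, hv, hv'⟩
        · exact h
        · exact absurd hv' (htw m hmi v hv)
      have hunit : P i r.rev = 1 := by
        have := h1 P (Or.inr hPu) hfc i r.rev (by rw [Fin.rev_rev]; exact h0); omega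
      obtain ⟨a, hai, ham, -⟩ := exists_fourth i m m
      obtain ⟨b, hbi, hbm, hba⟩ := exists_fourth i m a
      rcases hA.ruleD.2 P hPu i m (Ne.symm hmi) r.rev t.rev (by rw [hunit, ht0]; decide) with
          ⟨N, hNl, hag, hlt⟩ | ⟨N, hNl, hag, -⟩ | ⟨N, hNl, hag, hlt, -⟩
      · have hNfc : FC N := hA.fc_of_agree (Or.inl hNl) hfc (Ne.symm hba) (fun q => hag a q (fun h => hai h.1))
          (fun q => hag b q (fun h => hbi h.1))
        have := h1 N (Or.inl hNl) hNfc i r.rev (by rw [Fin.rev_rev, hag i r (fun h => ne_rev _ h.2)]; exact h0)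
        omega
      · have hNfc : FC N := hA.fc_of_agree (Or.inl hNl) hfc (Ne.symm hba) (fun q => hag a q (fun h => ham h.1))
          (fun q => hag b q (fun h => hbm h.1))
        exact hN N hNl hNfc i r (by rw [hag i r (fun h => hmi.symm h.1)]; exact h0)
      · have hNfc : FC N := hA.fc_of_agree (Or.inl hNl) hfc (Ne.symm hba) (fun q => hag a q (fun h => hai h.1) (fun h => ham h.1))
          (fun q => hag b q (fun h => hbi h.1) (fun h => hbm h.1))
        have := h1 N (Or.inl hNl) hNfc i r.rev
          (by rw [Fin.rev_rev, hag i r (fun h => ne_rev _ h.2) (fun h => hmi.symm h.1)]; exact h0)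
        omega
  exact fun X hX hfc => hX.elim (fun h => hN X h hfc) fun h => hP X h hfc

/-- **LEMMA X∞-B** (memo v4.1 §4): an admissible configuration has NO fully charged cell. (Largest ray charge `R`: `R ≥ 2` is
(B3)–(B5); `R ≤ 1` makes the world all-tower by (B6), emptied by (B1); no ray at all is (B1) directly.) -/
theorem Admissible.no_fc : ∀ X, (X ∈ C.lower ∨ X ∈ C.upper) → ¬ FC X := by
  intro X₀ hX₀ hfc₀
  set D : Finset (Cell × Fin 4 × Fin 2) :=
    ((((C.lower ∪ C.upper).filter fun X => FC X) ×ˢ ((univ : Finset (Fin 4)) ×ˢ (univ : Finset (Fin 2)))).filter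
      fun p => p.1 p.2.1 p.2.2.rev = 0) with hD
  have hmem : ∀ Z k t, (Z, k, t) ∈ D ↔ ((Z ∈ C.lower ∨ Z ∈ C.upper) ∧ FC Z) ∧ Z k t.rev = 0 := fun Z k t => by
    simp [hD, Finset.mem_filter, Finset.mem_product, Finset.mem_union]
  by_cases hne : D.Nonempty
  · obtain ⟨⟨Y, k, t⟩, hYD, hmax⟩ := Finset.exists_max_image D (fun p : Cell × Fin 4 × Fin 2 => p.1 p.2.1 p.2.2) hne
    obtain ⟨⟨hY, hYfc⟩, hYt⟩ := (hmem Y k t).1 hYD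
    have hR : ∀ Z, (Z ∈ C.lower ∨ Z ∈ C.upper) → FC Z → ∀ k' t', Z k' t'.rev = 0 → Z k' t' ≤ Y k t :=
      fun Z hZ hZfc k' t' h0 => hmax (Z, k', t') ((hmem Z k' t').2 ⟨⟨hZ, hZfc⟩, h0⟩)
    rcases Nat.lt_or_ge (Y k t) 2 with hlt | h2
    · exact hA.allTower_of_unit (fun Z hZ hZfc k' t' h0 => by have := hR Z hZ hZfc k' t' h0; omega) Y hY hYfc k t.rev hYt
    · exact hA.no_big_ray hR h2 hY hYfc rfl hYt
  · have hall : ∀ X, (X ∈ C.lower ∨ X ∈ C.upper) → FC X → ∀ i r, X i r ≠ 0 := fun X hX hfc i r h0 =>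
      hne ⟨(X, i, r.rev), (hmem X i r.rev).2 ⟨⟨hX, hfc⟩, by rw [Fin.rev_rev]; exact h0⟩⟩
    exact hA.b1 hall X₀ hX₀ hfc₀

/-! ## §6 THEOREM X∞ -/

/-- **THEOREM X∞ — (F1ℝ) SLICE, KERNEL FORM** (bc5-plan g4 memo v4.1 df3e4f41db3c2fcf; pencil ×1, LEG A ∕ LEG B routed at typing
time): in a RULE-D-closed, phase-sibling-closed, X-clean two-level configuration with all cells in `𝒰 = {O} ∪ {c·ℓ} ∪ {2I + c·ℓ}`
(`c ≥ 1` UNBOUNDED), EVERY cell has at least three O-factors («junk»). No Ψ-row, no FC1, no universe list, no height bound, no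
`decide` over a universe. The (E1)-meaning of RULE D and of X-cleanness (LEMMA X-PHASE at general depth) is pencil, as everywhere in
this directory; nothing here says HC ∕ HC_CM ∕ HC_AV holds or fails. -/
theorem Admissible.three_O {X : Cell} (hX : X ∈ C.lower ∨ X ∈ C.upper) : 3 ≤ X.key.count (0, 0) := by
  obtain ⟨f, hf⟩ : ∃ f, isO X f := by
    by_contra h
    push Not at h
    exact hA.no_fc X hX h
  rw [count_key]
  have hch : (univ.filter fun g => ¬ (0, 0) = nl X g).card ≤ 1 := Finset.card_le_one.2 fun a ha b hb => by
    rw [Finset.mem_filter] at ha hb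
    by_contra hab
    have haO : ¬ isO X a := fun h => ha.2 ((nl_eq_zero_iff X a).2 h).symm
    have hbO : ¬ isO X b := fun h => hb.2 ((nl_eq_zero_iff X b).2 h).symm
    exact hA.atMostOne hX hf (fun h => haO (by rw [h]; exact hf)) (fun h => hbO (by rw [h]; exact hf)) hab haO hbO
  have := Finset.card_filter_add_card_filter_not (s := (univ : Finset (Fin 4))) (fun g => (0, 0) = nl X g)
  simp only [Finset.card_univ, Fintype.card_fin] at this
  omega

end Main

/-- **THEOREM X∞ FOR DESIGNS — (F1ℝ) SLICE**: a two-level design (constituent lists, multiplicity by repetition) whose support is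
admissible (cells in `𝒰`, RULE-D-closed, PSC, X-clean) has `μ = 0`, i.e. violates (H1) — the memo's «first-order-dead in every
universe U ⊂ 𝒰», with NO Ψ-row hypothesis. -/
theorem xinf_muC_eq_zero (lower upper : List Cell) (hA : Admissible ⟨lower.toFinset, upper.toFinset⟩) : muC lower upper = 0 := by
  have hz : ∀ l : List Cell, (∀ X ∈ l, X ∈ lower.toFinset ∨ X ∈ upper.toFinset) → (l.map muTermC).sum = 0 := fun l hl =>
    List.sum_eq_zero fun x hx => by
      obtain ⟨X, hX, rfl⟩ := List.mem_map.1 hx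
      have h3 := hA.three_O (hl X hX)
      obtain ⟨f, hf⟩ := exists_of_mem_key (Multiset.count_pos.1 (by omega) : (0, 0) ∈ X.key)
      exact muTermC_eq_zero_of_O hf
  unfold muC
  rw [hz lower fun X hX => Or.inl (List.mem_toFinset.2 hX), hz upper fun X hX => Or.inr (List.mem_toFinset.2 hX), sub_zero]

/-! ## §7 Non-vacuity: a small admissible configuration (junk, as the theorem says) -/

/-- `lower = {[O|O|O|2ℓ₊], [O|O|O|2ℓ₋]}`, `upper = {[O|O|O|ℓ₊], [O|O|O|ℓ₋]}`. -/
def junkExample : Config where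
  lower := {cellOf 0 0 0 0 0 0 2 0, cellOf 0 0 0 0 0 0 0 2}
  upper := {cellOf 0 0 0 0 0 0 1 0, cellOf 0 0 0 0 0 0 0 1}

set_option synthInstance.maxSize 4096 in -- the unfolded predicates are one large decidable instance
/-- the example IS admissible (so `Admissible` is satisfiable and THEOREM X∞ is not vacuous): RULE D holds (the `2ℓ`'s own coordinate is
served by `ℓ`, the `ℓ`'s by `2ℓ` above), PSC holds (both siblings present), X-clean holds (the full cancellation `[O|O|O|O]` is absent).
[kernel, `decide`] -/
theorem junkExample_admissible : Admissible junkExample :=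
  ⟨by decide +kernel, by decide +kernel, by decide +kernel, by decide +kernel, by decide +kernel⟩

end Summit.Ventures.HSemireg.Pad4Tower
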